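import Literature.NumberTheory.LFunctions.WeilExplicit
import Mathlib
import HarnessLib

/-!
# HANDOFF — the COLLAR of the dodger: `Re k_θ(2A − 2δ) ≥ ∫_0^{2δ} g(σ)g(2δ−σ)dσ` and the mollifier transfer (rh-explicit, track «HANDOFF», seat prove-2 gen9, ATTEMPT-16 Lemma D2)

HONEST FRAMING. Nothing here bears on the truth of RH; this is elementary real analysis. In ATTEMPT-16 (HOME/handoff/prove-2/ATTEMPT-16.md
§5) the GAIN of the dodger witness is the collar `k_θ(L − 2δ) = ∫ θ(u)θ(u − (L − 2δ))du` of `θ = F₀ ⋆ φ_ε` at lag `L − 2δ = 2A − 2δ`,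
`A = b + ε` the half-width of `tsupport θ`: only `u ∈ [A − 2δ, A]` contributes, and there `θ` is controlled from below by the near-edge
profile of `F₀`. Lemma D2 = two transfers, both proved here for arbitrary data:

* **`collar_ge_of_edge_profile`** — if `θ` is a real, even Weil test function vanishing off `[−A, A]` and `Re θ(A − σ) ≥ g(σ) ≥ 0` for
  `σ ∈ [0, 2δ]`, then
  `Re (θ ⋆ θ̃)(2A − 2δ) ≥ ∫_{u ∈ [A−2δ, A]} g(A − u)·g(u − (A − 2δ)) du`
  (the integrand of the collar is `≥` this non-negative minorant on `[A − 2δ, A]` and `= 0` elsewhere by the supports);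
* **`re_weilConv_ge_of_profile`** — if `F` is real with `Re F(b − σ') ≥ m(σ')` for `σ' ∈ [0, 2δ]`, `m` non-decreasing, and `φ ≥ 0` is
  real of mass `1` vanishing off `[−ε, ε]`, then for `σ ∈ [2ε, 2δ]`: `Re (F ⋆ φ)(b + ε − σ) ≥ m(σ − 2ε)` (every point of the averaging
  window `[σ − 2ε, σ]` sees `F ≥ m(σ − 2ε)`); `re_weilConv_nonneg_of_profile` — if moreover `F(x) = 0` for `x > b` and `Re F(b − σ') ≥ 0` on
  `[0, 2δ]`, then `Re (F ⋆ φ)(b + ε − σ) ≥ 0` for every `σ ≤ 2δ`.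
Chained (with `A = b + ε`, `g(σ) = m(σ − 2ε)·1_{σ ≥ 2ε}`) these give ATTEMPT-16's
`k_θ(L − 2δ) ≥ 0.81(c_∞/2b)²∫_{2ε}^{2δ−2ε}Φ(p₁(σ−2ε)²)Φ(p₁(2δ−2ε−σ)²)dσ` once D1 supplies `m = 0.9(c_∞/2b)Φ(p₁·²)`.
No `sorry`, standard axioms, no definitions.

References: this track (ATTEMPT-16 §5, Lemma D2).
-/

set_option linter.dupNamespace false

noncomputable section

open Real MeasureTheory Set Complex
open scoped ComplexConjugate

namespace Summit.RiemannHypothesis.RiemannHypothesis.Theorems.Handoff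

open Literature.NumberTheory.LFunctions

/-! ## §1 The collar from an edge profile -/

/-- **The collar of a real even test function from a lower edge profile.** Let `θ` be a Weil test function, real
(`Im θ = 0`), even, vanishing off `[−A, A]`, and let `g ≥ 0` on `[0, 2δ]` with `g(σ) ≤ Re θ(A − σ)` there (`0 ≤ δ`), the minorant
`u ↦ g(A − u)·g(u − (A − 2δ))` being integrable on `[A − 2δ, A]`. Then
`∫_{[A−2δ, A]} g(A − u)·g(u − (A − 2δ)) du ≤ Re (θ ⋆ θ̃)(2A − 2δ)`. [this track, ATTEMPT-16 Lemma D2] -/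
theorem collar_ge_of_edge_profile {θ : ℝ → ℂ} (hθ : IsWeilTest θ) (hreal : ∀ u : ℝ, (θ u).im = 0)
    (heven : ∀ u : ℝ, θ (-u) = θ u) {A : ℝ} (hsupp : ∀ u : ℝ, A < |u| → θ u = 0)
    {δ : ℝ} {g : ℝ → ℝ} (hg0 : ∀ σ ∈ Icc 0 (2 * δ), 0 ≤ g σ)
    (hg : ∀ σ ∈ Icc 0 (2 * δ), g σ ≤ (θ (A - σ)).re)
    (hgi : IntegrableOn (fun u : ℝ => g (A - u) * g (u - (A - 2 * δ))) (Icc (A - 2 * δ) A)) :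
    ∫ u in Icc (A - 2 * δ) A, g (A - u) * g (u - (A - 2 * δ)) ≤
      (weilConv θ (weilReflect θ) (2 * A - 2 * δ)).re := by
  set t : ℝ := 2 * A - 2 * δ with ht
  -- the collar integrand and its real form
  have hθc : Continuous θ := hθ.1.continuous
  have hint : Integrable fun u : ℝ => θ u * weilReflect θ (t - u) := by
    have hc : Continuous fun u : ℝ => θ u * weilReflect θ (t - u) := by
      refine hθc.mul ?_
      unfold weilReflect
      exact (Complex.continuous_conj.comp (hθc.comp (continuous_const.sub continuous_id).neg))
    refine hc.integrable_of_hasCompactSupport ?_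
    exact hθ.2.mul_right
  rw [weilConv_apply, ← RCLike.re_eq_complex_re, ← integral_re hint]
  -- pointwise: the real integrand dominates the minorant `ℓ = 1_{[A−2δ,A]}·g(A−u)g(u−(A−2δ))`
  have hre : ∀ u : ℝ, RCLike.re (θ u * weilReflect θ (t - u)) = (θ u).re * (θ (u - t)).re := by
    intro u
    have e1 : weilReflect θ (t - u) = conj (θ (u - t)) := by
      simp only [weilReflect, neg_sub]
    rw [e1, RCLike.re_eq_complex_re, Complex.mul_re, Complex.conj_re, Complex.conj_im, hreal u]
    ring
  simp_rw [hre]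
  rw [← integral_indicator measurableSet_Icc]
  refine integral_mono ?_ ?_ fun u => ?_
  · exact hgi.integrable_indicator measurableSet_Icc
  · have : (fun u : ℝ => (θ u).re * (θ (u - t)).re) = fun u => RCLike.re (θ u * weilReflect θ (t - u)) := by
      funext u; exact (hre u).symm
    rw [this]
    exact hint.re
  · -- pointwise comparison
    by_cases hu : u ∈ Icc (A - 2 * δ) A
    · rw [indicator_of_mem hu]
      have hσ : A - u ∈ Icc 0 (2 * δ) := ⟨by linarith [hu.2], by linarith [hu.1]⟩
      have hσ' : u - (A - 2 * δ) ∈ Icc 0 (2 * δ) := ⟨by linarith [hu.1], by linarith [hu.2]⟩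
      have h1 : g (A - u) ≤ (θ u).re := by
        have := hg (A - u) hσ; rwa [show A - (A - u) = u by ring] at this
      have h2 : g (u - (A - 2 * δ)) ≤ (θ (u - t)).re := by
        have := hg (u - (A - 2 * δ)) hσ'
        rw [show A - (u - (A - 2 * δ)) = -(u - t) by rw [ht]; ring, heven] at this
        exact this
      exact mul_le_mul h1 h2 (hg0 _ hσ') ((hg0 _ hσ).trans h1)
    · rw [indicator_of_notMem hu]
      -- outside the collar one factor vanishes
      rcases not_and_or.1 (fun h => hu (mem_Icc.2 h)) with h | h
      · have hlt : u < A - 2 * δ := lt_of_not_ge h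
        have : θ (u - t) = 0 := by
          refine hsupp _ ?_
          rw [ht]
          have : u - (2 * A - 2 * δ) < -A := by linarith
          calc A < -(u - (2 * A - 2 * δ)) := by linarith
            _ ≤ |u - (2 * A - 2 * δ)| := neg_le_abs _
        rw [this]; simp
      · have hgt : A < u := lt_of_not_ge h
        have : θ u = 0 := hsupp u (hgt.trans_le (le_abs_self u))
        rw [this]; simp

/-! ## §2 The mollifier transfer -/

/-- **Mollifier transfer of a monotone edge profile.** Let `F` be real with `Re F(b − σ') ≥ m(σ')` for `σ' ∈ [0, 2δ]`, where `m` is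
non-decreasing on `[0, 2δ]`; let `φ ≥ 0` be real of mass `∫φ = 1`, vanishing off `[−ε, ε]` (`ε ≥ 0`), with
`u ↦ F(u)φ(x − u)` integrable for the `x` in question. Then for `σ ∈ [2ε, 2δ]`: `m(σ − 2ε) ≤ Re (F ⋆ φ)(b + ε − σ)`.
[this track, ATTEMPT-16 Lemma D2] -/
theorem re_weilConv_ge_of_profile {F φ : ℝ → ℂ} (hFreal : ∀ u : ℝ, (F u).im = 0) {b : ℝ}
    {δ : ℝ} {m : ℝ → ℝ} (hmono : MonotoneOn m (Icc 0 (2 * δ)))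
    (hFm : ∀ σ ∈ Icc 0 (2 * δ), m σ ≤ (F (b - σ)).re)
    (hφreal : ∀ v : ℝ, (φ v).im = 0) (hφ0 : ∀ v : ℝ, 0 ≤ (φ v).re) {ε : ℝ} (hε : 0 ≤ ε)
    (hφsupp : ∀ v : ℝ, ε < |v| → φ v = 0) (hφmass : ∫ v, φ v = 1) (hφi : Integrable φ)
    {σ : ℝ} (hσ1 : 2 * ε ≤ σ) (hσ2 : σ ≤ 2 * δ)
    (hint : Integrable fun u : ℝ => F u * φ (b + ε - σ - u)) :
    m (σ - 2 * ε) ≤ (weilConv F φ (b + ε - σ)).re := by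
  set x : ℝ := b + ε - σ with hx
  rw [weilConv_apply, ← RCLike.re_eq_complex_re, ← integral_re hint]
  -- compare with `∫ m(σ−2ε)·Re φ(x − u) du = m(σ−2ε)`
  have hmass' : ∫ u : ℝ, (φ (x - u)).re = 1 := by
    have h1 : ∫ u : ℝ, φ (x - u) = ∫ v : ℝ, φ v := integral_sub_left_eq_self φ volume x
    have h2 : ∫ u : ℝ, (φ (x - u)).re = (∫ u : ℝ, φ (x - u)).re := by
      have := integral_re (hφi.comp_sub_left x)
      simpa only [RCLike.re_eq_complex_re] using this
    rw [h2, h1, hφmass, Complex.one_re]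
  have hlow : m (σ - 2 * ε) = ∫ u : ℝ, m (σ - 2 * ε) * (φ (x - u)).re := by
    rw [integral_const_mul, hmass', mul_one]
  rw [hlow]
  have hσε : σ - 2 * ε ∈ Icc 0 (2 * δ) := ⟨by linarith, by linarith⟩
  refine integral_mono ?_ hint.re fun u => ?_
  · exact (hφi.comp_sub_left x).re.const_mul _
  · -- pointwise: `m(σ−2ε)·φ(x−u) ≤ Re(F u · φ(x−u)) = Re F(u) · Re φ(x−u)`
    have e : RCLike.re (F u * φ (x - u)) = (F u).re * (φ (x - u)).re := by
      rw [RCLike.re_eq_complex_re, Complex.mul_re, hFreal u, hφreal (x - u)]; ring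
    rw [e]
    rcases le_or_gt |x - u| ε with hv | hv
    · -- inside the window: `u = b − σ'` with `σ' = σ − ε − (x − u) ∈ [σ − 2ε, σ] ⊆ [0, 2δ]`
      refine mul_le_mul_of_nonneg_right ?_ (hφ0 _)
      have hv' := abs_le.1 hv
      set σ' : ℝ := b - u with hσ'
      have h1 : σ - 2 * ε ≤ σ' := by rw [hσ', hx] at *; linarith [hv'.2]
      have h2 : σ' ≤ σ := by rw [hσ', hx] at *; linarith [hv'.1]
      have hσ'mem : σ' ∈ Icc 0 (2 * δ) := ⟨by linarith [hσε.1], by linarith⟩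
      calc m (σ - 2 * ε) ≤ m σ' := hmono hσε hσ'mem h1
        _ ≤ (F (b - σ')).re := hFm σ' hσ'mem
        _ = (F u).re := by rw [hσ', sub_sub_cancel]
    · rw [hφsupp _ hv]; simp

/-- **Non-negativity of the mollified edge**: under the same hypotheses, `0 ≤ Re (F ⋆ φ)(b + ε − σ)` for every `σ ∈ [0, 2δ]`
(`δ ≥ 0`): every point of the averaging window sees `F ≥ 0` or `F = 0`. [this track, ATTEMPT-16 Lemma D2] -/
theorem re_weilConv_nonneg_of_profile {F φ : ℝ → ℂ} (hFreal : ∀ u : ℝ, (F u).im = 0) {b : ℝ} (hFb : ∀ x : ℝ, b < x → F x = 0)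
    {δ : ℝ} (hF0 : ∀ σ ∈ Icc 0 (2 * δ), 0 ≤ (F (b - σ)).re)
    (hφreal : ∀ v : ℝ, (φ v).im = 0) (hφ0 : ∀ v : ℝ, 0 ≤ (φ v).re) {ε : ℝ}
    (hφsupp : ∀ v : ℝ, ε < |v| → φ v = 0) {σ : ℝ} (hσ2 : σ ≤ 2 * δ)
    (hint : Integrable fun u : ℝ => F u * φ (b + ε - σ - u)) :
    0 ≤ (weilConv F φ (b + ε - σ)).re := by
  set x : ℝ := b + ε - σ with hx
  rw [weilConv_apply, ← RCLike.re_eq_complex_re, ← integral_re hint]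
  refine integral_nonneg fun u => ?_
  have e : RCLike.re (F u * φ (x - u)) = (F u).re * (φ (x - u)).re := by
    rw [RCLike.re_eq_complex_re, Complex.mul_re, hFreal u, hφreal (x - u)]; ring
  simp only [e]
  rcases le_or_gt |x - u| ε with hv | hv
  · refine mul_nonneg ?_ (hφ0 _)
    have hv' := abs_le.1 hv
    rcases lt_or_ge b u with hbu | hbu
    · rw [hFb u hbu]; simp
    · have hσ'mem : b - u ∈ Icc 0 (2 * δ) := ⟨by linarith, by rw [hx] at hv'; linarith [hv'.1]⟩
      have := hF0 (b - u) hσ'mem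
      rwa [sub_sub_cancel] at this
  · rw [hφsupp _ hv]; simp

end Summit.RiemannHypothesis.RiemannHypothesis.Theorems.Handoff

end
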